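import Literature.Probability.LatticeModels.ImprovedTreeDiagramBoundProofs
import Literature.Probability.LatticeModels.TwoPointGradientEstimate
import Literature.Probability.LatticeModels.SlidingScaleInfraredBoundProofs
import HarnessLib

/-!
# Regular scales of the two-point function (Aizenman–Duminil-Copin 2021, Definition 5.11 and Theorem 5.12)

Topic `Literature/Probability/LatticeModels`; family `crit-ising` (crit-ising.S13). No named fact is
introduced; the only definitions are the annuli `ann`, the `ℓ¹` distance `Site.l1Dist`, the coordinate
hull `Site.InHull`, and the regularity predicate `IsRegularScale` (ADC Def. 5.11).

M. Aizenman, H. Duminil-Copin, *Marginal triviality of the scaling limits of critical 4D Ising and `φ⁴₄`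
models*, Ann. of Math. **194** (2021) = arXiv:1912.07973, §5.6 "Regular scales" (p. 20):

  **Definition 5.11.** "Fix `c, C > 0`. An annular region `Ann(n/2, 4n)` is said to be *regular* if the
  following four properties are satisfied:
  P1 for every `x, y ∈ Ann(n/2,4n)`, `S(y) ≤ C S(x)`;
  P2 for every `x, y ∈ Ann(n/2,4n)`, `|S(x) - S(y)| ≤ C |x-y|/|x| · S(x)`;
  P3 for every `x ∈ Λ_n` and `y ∉ Λ_{Cn}`, `S(y) ≤ ½ S(x)`;
  P4 `χ_{2n} ≥ (1+c) χ_n`.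
  A scale `k` is said to be regular if the above holds for `n = 2^k`, and a vertex `x ∈ ℤ^d` will be said
  to be in a regular scale if it belongs to an annulus with the above properties."

  **Theorem 5.12 (Abundance of regular scales).** "Fix `d > 2` and `α > 2`. There exist `c = c(d) > 0` and
  `C = C(d) > 0` such that for every n.n.f. model in the GS class and every `n^α ≤ N ≤ ξ(ρ,β)`, there are
  at least `c log₂(N/n)` regular scales `k` with `n ≤ 2^k ≤ N`."

Here `|·|` is the sup norm (§4, "Below, `|·|` denotes the infinity-norm"), `Ann(k,n) = Λ_n ∖ Λ_{k-1}`,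
`χ_L = ∑_{x ∈ Λ_L} S(x)` (`boxSusceptibility`), `S(x) = ⟨σ₀σ_x⟩_β`.

## Contents

* Part A. `ann d a b = {a ≤ ‖x‖_∞ ≤ b}`, `IsRegularScale S c C n` (P1–P4 for an arbitrary `S : ℤ^d → ℝ`).
* Part B. P2 from single steps: the `ℓ¹`-path lemma `abs_sub_le_mul_l1Dist_of_steps` (if every unit
  step inside a set `T` changes `f` by at most `κ`, and the coordinate hull of `x, y` lies in `T`, then
  `|f x - f y| ≤ κ ‖x - y‖₁`).
* Part C. The pigeonhole of the printed proof ("Using the sliding-scale Infrared Bound, there exist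
  `r, c₂ > 0` such that there are at least `c₂ log₂(N/n)` scales `m = 2^k` between `n` and `N` such
  that `χ_{rm} ≥ χ_{4dm} + χ_m`"): for a positive non-decreasing `χ` with the doubling bound
  `χ_{2t} ≤ D χ_t`, along the scales `m_i = 2^{k₀ + iJ}` the total logarithmic growth of `χ` is at most
  `J log D` per growth scale plus `log 2` per other scale (`log_growth_le_card_mul_add`).
* Part D. The verification step of the printed proof for the four-dimensional model
  (`S = ⟨σ₀σ_x⟩^∅_β = twoPointFree 4 β`, `β ≥ 0` with `m*(β) = 0`): at a *growth scale* `m = 64q`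
  (`χ_{rm} ≥ χ_{32m} + χ_m`, the printed `χ_{rm} ≥ χ_{4dm} + χ_m` with the range constant `4d` enlarged
  to `32`) the two-point function is comparable within the factor `Θ = (64r)⁴` on
  `{m/16 ≤ ‖z‖_∞ ≤ 8m}` (MMS: `S(y) ≤ S(‖y‖_∞ e₁)`, `S(4‖x‖_∞ e₁) ≤ S(x)`, and
  `|Ann| S(32 m e₁) ≥ χ_{rm} - χ_{32m} ≥ χ_m ≥ |Λ_{m/64}| S(m/16 e₁)`), whence P1, P4 (`c = 1/(2r⁴)`), P3
  (granting the sliding-scale infrared bound `χ_{Rm} ≤ K R² χ_m`, ADC Thm 5.6, with `8R² ≥ 81Kr⁴`) and P2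
  (single steps: the Duminil-Copin–Panis gradient estimate `twoPointFree_gradient_estimate` along a
  coordinate `≥ m/8`, the diagonal Messager–Miracle-Solé inequality and a reflection for the small
  coordinates — "use the Messager-Miracle-Sole inequality applied twice", proof of ADC Prop. 5.9 — then
  the path lemma): `isRegularScale_of_growth`. The count of growth scales in the window `N ≤ ξ(β)`
  (Theorem 5.12 proper, from Part C with the lower bound on sphere sums, the infrared bound and
  Thm 5.6) is the business of the sibling file `RegularScalesAbundance`.

Remark (for the users of Thm 5.12 in §6.2). The printed hypothesis `n^α ≤ N` is essential to the
count (the growth of `χ` between `n` and `N` is forced only when `N ≫ n²`); in the proof of the mixing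
Theorem 6.4 the set `𝒦` of regular scales between `m` and `M/2` must therefore be extracted from the
regular scales between `n` and `M/2` (choosing `m/n = (N/n)^{μ'}` with `μ'` small compared with the
constant of Thm 5.12), as the count cannot be applied to the pair `(m, M/2)` itself (`M < m²` there;
cf. Panis 2023, arXiv:2309.05797, §6.4, where `m/n = (N/n)^{μ/2}`, `N/M = (N/n)^{1-μ}`).

## References

* M. Aizenman, H. Duminil-Copin, Ann. of Math. 194 (2021), arXiv:1912.07973, §5.6, Def. 5.11 and
  Thm 5.12 with its proof (p. 20); uses: Lemma 6.2, Remark 6.5, Thm 6.4, proof of Prop. 6.1 (pp. 21–26)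
  [AizenmanDuminilCopinAnnals2021].

* R. Panis, arXiv:2309.05797 (2023), Def. 3.27 and Prop. 3.28 (the same notion with `Ann(n/2, 8n)`, and
  the same proof) [Panis2023Triviality].
* H. Duminil-Copin, R. Panis, Comm. Math. Phys. 406 (2025), arXiv:2404.05700, eq. (1.11) (the gradient
  estimate in the form used here, `TwoPointGradientEstimate`) [DuminilCopinPanis2025LowerBounds].

## Mathlib

`Finset.sum_range_sub` (telescoping), `Real.log_le_log`, `Finset.sum_boole`, `Fintype.sum` over `Fin d`,
`Pi.single`, `Function.update`, `Int.natAbs` arithmetic, `nlinarith`.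
-/

noncomputable section

open MeasureTheory Filter Topology Finset

namespace Literature.Probability.LatticeModels

variable {d : ℕ}

/-! ### Part A. Annuli and the regularity predicate (ADC Def. 5.11) -/

/-- The annulus `Ann(a, b) = Λ_b ∖ Λ_{a-1} = {x ∈ ℤ^d : a ≤ ‖x‖_∞ ≤ b}` (Aizenman–Duminil-Copin 2021,
§4.1, before Lemma 4.2). [cite: AizenmanDuminilCopinAnnals2021, arXiv:1912.07973 §4.1, definition of Ann(k,n) (p. 10)] -/
def ann (d a b : ℕ) : Finset (Site d) := (box d b).filter fun x => a ≤ Site.supNorm x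

/-- Membership in `Ann(a, b)`: `a ≤ ‖x‖_∞ ≤ b`. [folklore] -/
theorem mem_ann {a b : ℕ} {x : Site d} : x ∈ ann d a b ↔ a ≤ Site.supNorm x ∧ Site.supNorm x ≤ b := by
  rw [ann, Finset.mem_filter, mem_box_iff_supNorm_le]
  exact and_comm

/-- `Ann(a, b) ⊆ Λ_b`. [folklore] -/
theorem ann_subset_box (d a b : ℕ) : ann d a b ⊆ box d b := Finset.filter_subset _ _

/-- Annuli are monotone in their radii. [folklore] -/
theorem ann_mono {a a' b b' : ℕ} (ha : a' ≤ a) (hb : b ≤ b') : ann d a b ⊆ ann d a' b' := fun x hx => by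
  rw [mem_ann] at hx ⊢
  exact ⟨ha.trans hx.1, hx.2.trans hb⟩

/-- **Aizenman–Duminil-Copin 2021, Definition 5.11 (regular annular region / regular scale).** For a
function `S : ℤ^d → ℝ` (the two-point function `S(x) = ⟨σ₀σ_x⟩`), constants `c, C` and `n ∈ ℕ`, the
annular region `Ann(n/2, 4n)` is `(c, C)`-regular when:
P1 `S(y) ≤ C S(x)` for all `x, y ∈ Ann(n/2, 4n)`;
P2 `|S(x) - S(y)| ≤ C (‖x-y‖_∞/‖x‖_∞) S(x)` for all `x, y ∈ Ann(n/2, 4n)`;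
P3 `S(y) ≤ S(x)/2` for all `x ∈ Λ_n` and all `y ∉ Λ_{Cn}` (`‖y‖_∞ > Cn`);
P4 `χ_{2n} ≥ (1 + c) χ_n`, `χ_L = ∑_{x ∈ Λ_L} S(x)` (`boxSusceptibility`).
"A scale `k` is said to be regular if the above holds for `n = 2^k`." Norms are sup norms
(`Site.supNorm`, `= ‖·‖` by `Site.norm_eq_supNorm`); `n/2` is integer division (exact for the scales
`n = 2^k`, `k ≥ 1`). [cite: AizenmanDuminilCopinAnnals2021, arXiv:1912.07973 Definition 5.11 (p. 20)] -/
structure IsRegularScale (S : Site d → ℝ) (c C : ℝ) (n : ℕ) : Prop where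
  p1 : ∀ x ∈ ann d (n / 2) (4 * n), ∀ y ∈ ann d (n / 2) (4 * n), S y ≤ C * S x
  p2 : ∀ x ∈ ann d (n / 2) (4 * n), ∀ y ∈ ann d (n / 2) (4 * n),
    |S x - S y| ≤ C * ((Site.supNorm (x - y) : ℝ) / Site.supNorm x) * S x
  p3 : ∀ x ∈ box d n, ∀ y : Site d, C * n < Site.supNorm y → S y ≤ S x / 2
  p4 : (1 + c) * boxSusceptibility S n ≤ boxSusceptibility S (2 * n : ℕ)

/-- "A vertex `x ∈ ℤ^d` will be said to be in a regular scale if it belongs to an annulus with the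
above properties" (Aizenman–Duminil-Copin 2021, Def. 5.11): `x ∈ Ann(2^k/2, 4·2^k)` for some regular
scale `k`. [cite: AizenmanDuminilCopinAnnals2021, arXiv:1912.07973 Definition 5.11 (p. 20)] -/
def InRegularScale (S : Site d → ℝ) (c C : ℝ) (x : Site d) : Prop :=
  ∃ k : ℕ, IsRegularScale S c C (2 ^ k) ∧ x ∈ ann d (2 ^ k / 2) (4 * 2 ^ k)

/-- Regularity is monotone in the constants: smaller `c` and larger `C` are weaker requirements
(`C ≥ 0`, `S ≥ 0` for P1/P2, `C ≤ C'` for P3). [folklore] -/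
theorem IsRegularScale.mono {S : Site d → ℝ} {c c' C C' : ℝ} {n : ℕ} (h : IsRegularScale S c C n)
    (hS : ∀ x, 0 ≤ S x) (hc : c' ≤ c) (hC : C ≤ C') : IsRegularScale S c' C' n where
  p1 x hx y hy := (h.p1 x hx y hy).trans (mul_le_mul_of_nonneg_right hC (hS x))
  p2 x hx y hy := (h.p2 x hx y hy).trans
    (mul_le_mul_of_nonneg_right (mul_le_mul_of_nonneg_right hC (by positivity)) (hS x))
  p3 x hx y hy := h.p3 x hx y ((mul_le_mul_of_nonneg_right hC (Nat.cast_nonneg n)).trans_lt hy)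
  p4 := le_trans (mul_le_mul_of_nonneg_right (by linarith)
    (boxSusceptibility_nonneg hS _)) h.p4

/-! ### Part B. P2 from single steps: paths in the `ℓ¹` metric -/

/-- The `ℓ¹` distance on `ℤ^d`, `‖x - y‖₁ = ∑ᵢ |xᵢ - yᵢ|`, as a natural number. [folklore] -/
def Site.l1Dist (x y : Site d) : ℕ := ∑ i, (x i - y i).natAbs

/-- `‖x - x‖₁ = 0`. [folklore] -/
theorem Site.l1Dist_self (x : Site d) : Site.l1Dist x x = 0 := by simp [Site.l1Dist]

/-- `‖x - y‖₁ = 0 ↔ x = y`. [folklore] -/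
theorem Site.l1Dist_eq_zero_iff {x y : Site d} : Site.l1Dist x y = 0 ↔ x = y := by
  constructor
  · intro h
    funext i
    have hi : (x i - y i).natAbs = 0 :=
      (Finset.sum_eq_zero_iff.1 h) i (Finset.mem_univ i)
    omega
  · rintro rfl; exact Site.l1Dist_self x

/-- `‖x - y‖₁ ≤ d ‖x - y‖_∞`. [folklore] -/
theorem Site.l1Dist_le_mul_supNorm (x y : Site d) : Site.l1Dist x y ≤ d * Site.supNorm (x - y) := by
  unfold Site.l1Dist
  calc ∑ i, (x i - y i).natAbs ≤ ∑ _i : Fin d, Site.supNorm (x - y) :=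
        Finset.sum_le_sum fun i _ => Site.natAbs_le_supNorm (x - y) i
    _ = d * Site.supNorm (x - y) := by simp

/-- The coordinate hull of two sites: `z` lies coordinatewise between `x` and `y`. [folklore] -/
def Site.InHull (x y z : Site d) : Prop := ∀ i, min (x i) (y i) ≤ z i ∧ z i ≤ max (x i) (y i)

/-- `x` lies in the hull of `x, y`. [folklore] -/
theorem Site.inHull_left (x y : Site d) : Site.InHull x y x := fun _ => ⟨min_le_left _ _, le_max_left _ _⟩

/-- `y` lies in the hull of `x, y`. [folklore] -/
theorem Site.inHull_right (x y : Site d) : Site.InHull x y y := fun _ => ⟨min_le_right _ _, le_max_right _ _⟩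

/-- A point of the hull is within sup-distance `‖x - y‖_∞` of `x`. [folklore] -/
theorem Site.supNorm_sub_le_of_inHull {x y z : Site d} (h : Site.InHull x y z) :
    Site.supNorm (z - x) ≤ Site.supNorm (x - y) := by
  rw [Site.supNorm_le_iff]
  intro i
  obtain ⟨h1, h2⟩ := h i
  have h3 := Site.natAbs_le_supNorm (x - y) i
  simp only [Pi.sub_apply] at h3 ⊢
  have : (z i - x i).natAbs ≤ (x i - y i).natAbs := by
    rcases le_total (x i) (y i) with hxy | hxy
    · rw [min_eq_left hxy, max_eq_right hxy] at *; omega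
    · rw [min_eq_right hxy, max_eq_left hxy] at *; omega
  exact this.trans h3

/-- **The path lemma.** If every unit step `z → z + eᵢ` from a point `z ∈ T` changes `f` by at most
`κ`, then for all `x, y` whose coordinate hull lies in `T`, `|f(x) - f(y)| ≤ κ ‖x - y‖₁` (move one
unit at a time towards `y`; this is how P2 of a regular scale is obtained from the one-step gradient
estimate, Aizenman–Duminil-Copin 2021, proof of Thm 5.12: "P2 by the gradient estimate given by
Proposition 5.9"). [cite: AizenmanDuminilCopinAnnals2021, arXiv:1912.07973 proof of Theorem 5.12 (p. 20)] -/
theorem abs_sub_le_mul_l1Dist_of_steps {f : Site d → ℝ} {T : Set (Site d)} {κ : ℝ}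
    (hstep : ∀ z ∈ T, ∀ i : Fin d, |f (z + Pi.single i 1) - f z| ≤ κ) :
    ∀ (n : ℕ) (x y : Site d), Site.l1Dist x y = n → (∀ z, Site.InHull x y z → z ∈ T) →
      |f x - f y| ≤ κ * n := by
  intro n
  induction n with
  | zero =>
      intro x y hxy _
      rw [Site.l1Dist_eq_zero_iff.1 hxy, sub_self, abs_zero, Nat.cast_zero, mul_zero]
  | succ n ih =>
      intro x y hxy hT
      -- a coordinate in which `x` and `y` differ
      obtain ⟨i, hi⟩ : ∃ i, x i ≠ y i := by
        by_contra hall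
        push Not at hall
        have : x = y := funext hall
        rw [this, Site.l1Dist_self] at hxy
        exact Nat.succ_ne_zero n hxy.symm
      -- one step towards `y` in that coordinate
      set s : ℤ := if x i < y i then 1 else -1 with hs
      set x' : Site d := x + Pi.single i s with hx'
      have hx'i : x' i = x i + s := by simp [hx']
      have hx'j : ∀ j, j ≠ i → x' j = x j := fun j hj => by simp [hx', hj]
      -- the new point is in the hull, and its hull with `y` is inside the old one
      have hbetween : min (x i) (y i) ≤ x' i ∧ x' i ≤ max (x i) (y i) := by
        rw [hx'i, hs]
        split_ifs with hlt
        · rw [min_eq_left hlt.le, max_eq_right hlt.le]; omega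
        · push Not at hlt
          have hlt' : y i < x i := lt_of_le_of_ne hlt (Ne.symm hi)
          rw [min_eq_right hlt'.le, max_eq_left hlt'.le]; omega
      have hhull : ∀ z, Site.InHull x' y z → Site.InHull x y z := by
        intro z hz j
        obtain ⟨hz1, hz2⟩ := hz j
        by_cases hj : j = i
        · subst hj
          obtain ⟨hb1, hb2⟩ := hbetween
          exact ⟨(le_min hb1 (min_le_right _ _)).trans hz1, hz2.trans (max_le hb2 (le_max_right _ _))⟩
        · rw [hx'j j hj] at hz1 hz2
          exact ⟨hz1, hz2⟩
      have hx'T : ∀ z, Site.InHull x' y z → z ∈ T := fun z hz => hT z (hhull z hz)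
      -- the distance drops by one
      have hdist : Site.l1Dist x' y = n := by
        have hsum : ∀ w : Site d, Site.l1Dist w y =
            (w i - y i).natAbs + ∑ j ∈ Finset.univ.erase i, (w j - y j).natAbs := fun w => by
          rw [Site.l1Dist, ← Finset.add_sum_erase _ _ (Finset.mem_univ i)]
        have h1 := hsum x
        have h2 := hsum x'
        have hrest : ∑ j ∈ Finset.univ.erase i, (x' j - y j).natAbs =
            ∑ j ∈ Finset.univ.erase i, (x j - y j).natAbs :=
          Finset.sum_congr rfl fun j hj => by rw [hx'j j (Finset.ne_of_mem_erase hj)]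
        have hstepi : (x' i - y i).natAbs + 1 = (x i - y i).natAbs := by
          rw [hx'i, hs]
          split_ifs with hlt
          · omega
          · push Not at hlt
            have hlt' : y i < x i := lt_of_le_of_ne hlt (Ne.symm hi)
            omega
        rw [hxy] at h1
        omega
      -- the single step
      have hxT : x ∈ T := hT x (Site.inHull_left x y)
      have hx'mem : x' ∈ T := hT x' (fun j => by
        by_cases hj : j = i
        · subst hj; exact hbetween
        · rw [hx'j j hj]; exact ⟨min_le_left _ _, le_max_left _ _⟩)
      have hone : |f x - f x'| ≤ κ := by
        rw [hx', hs]
        split_ifs with hlt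
        · rw [abs_sub_comm]
          exact hstep x hxT i
        · have heq : x = (x + Pi.single i (-1 : ℤ)) + Pi.single i 1 := by
            rw [add_assoc, ← Pi.single_add]; simp
          have h := hstep (x + Pi.single i (-1 : ℤ)) (by
            have : x' = x + Pi.single i (-1 : ℤ) := by rw [hx', hs, if_neg hlt]
            rw [← this]; exact hx'mem) i
          rw [← heq] at h
          exact h
      calc |f x - f y| = |(f x - f x') + (f x' - f y)| := by ring_nf
        _ ≤ |f x - f x'| + |f x' - f y| := abs_add_le _ _
        _ ≤ κ + κ * n := add_le_add hone (ih x' y hdist hx'T)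
        _ = κ * (n + 1 : ℕ) := by push_cast; ring

/-! ### Part C. The pigeonhole on the dyadic growth of `χ` -/

/-- Iterated doubling: `χ(2^J t) ≤ D^J χ(t)` for `t ≥ 1` from `χ(2t) ≤ D χ(t)` (`D ≥ 0`). [folklore] -/
theorem apply_two_pow_mul_le {χ : ℕ → ℝ} {D : ℝ} (hD : 0 ≤ D)
    (hdouble : ∀ t : ℕ, 1 ≤ t → χ (2 * t) ≤ D * χ t) (J : ℕ) {t : ℕ} (ht : 1 ≤ t) :
    χ (2 ^ J * t) ≤ D ^ J * χ t := by
  induction J with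
  | zero => simp
  | succ J ih =>
      have h1 : 1 ≤ 2 ^ J * t := Nat.one_le_iff_ne_zero.2 (Nat.mul_ne_zero (pow_ne_zero _ two_ne_zero) (by omega))
      calc χ (2 ^ (J + 1) * t) = χ (2 * (2 ^ J * t)) := by rw [pow_succ]; ring_nf
        _ ≤ D * χ (2 ^ J * t) := hdouble _ h1
        _ ≤ D * (D ^ J * χ t) := mul_le_mul_of_nonneg_left ih hD
        _ = D ^ (J + 1) * χ t := by rw [pow_succ]; ring

/-- **The pigeonhole of the proof of Theorem 5.12.** Let `χ : ℕ → ℝ` be positive and non-decreasing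
with the doubling bound `χ(2t) ≤ D χ(t)` (`t ≥ 1`, `D ≥ 1`; for the two-point function this is the
sliding-scale infrared bound, ADC Thm 5.6). Along the scales `m_i = 2^{k₀ + iJ}` (`J ≥ 1`) and for
`a ≥ 1`, call `i` a growth index if `χ(a m_{i+1}) ≥ χ(a m_i) + χ(m_i)` (the printed
"`χ_{rm} ≥ χ_{4dm} + χ_m`" with `r = a 2^J`). Then the logarithmic growth from `a m_0` to `a m_I` is at
most `J log D` per growth index plus `log 2` per index:
`log χ(a m_I) - log χ(a m_0) ≤ (J log D) · #{i < I : growth} + I log 2`. Combined with a lower bound on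
the left side this is "there are at least `c₂ log₂(N/n)` scales `m = 2^k` between `n` and `N` such that
`χ_{rm} ≥ χ_{4dm} + χ_m`". [cite: AizenmanDuminilCopinAnnals2021, arXiv:1912.07973 proof of Theorem 5.12, second display (p. 20)] -/
theorem log_growth_le_card_mul_add {χ : ℕ → ℝ} (hpos : ∀ t, 0 < χ t) (hmono : Monotone χ) {D : ℝ}
    (hD : 1 ≤ D) (hdouble : ∀ t : ℕ, 1 ≤ t → χ (2 * t) ≤ D * χ t) {a J : ℕ} (ha : 1 ≤ a) (k₀ I : ℕ) :
    Real.log (χ (a * 2 ^ (k₀ + I * J))) - Real.log (χ (a * 2 ^ k₀)) ≤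
      (J * Real.log D) *
          #((Finset.range I).filter fun i =>
            χ (a * 2 ^ (k₀ + i * J)) + χ (2 ^ (k₀ + i * J)) ≤ χ (a * 2 ^ (k₀ + (i + 1) * J))) +
        I * Real.log 2 := by
  classical
  set m : ℕ → ℕ := fun i => 2 ^ (k₀ + i * J) with hm
  set g : ℕ → ℝ := fun i => Real.log (χ (a * m i)) with hg
  have hm1 : ∀ i, 1 ≤ m i := fun i => Nat.one_le_two_pow
  have hmsucc : ∀ i, a * m (i + 1) = 2 ^ J * (a * m i) := fun i => by
    simp only [hm]; rw [show k₀ + (i + 1) * J = (k₀ + i * J) + J by ring, pow_add]; ring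
  have hlogD : 0 ≤ Real.log D := Real.log_nonneg hD
  -- one step
  have hstep : ∀ i, g (i + 1) - g i ≤
      (J * Real.log D) * (if χ (a * m i) + χ (m i) ≤ χ (a * m (i + 1)) then 1 else 0) + Real.log 2 := by
    intro i
    have hami : 1 ≤ a * m i := Nat.one_le_iff_ne_zero.2 (Nat.mul_ne_zero (by omega) (by
      have := hm1 i; omega))
    simp only [hg]
    rw [← Real.log_div (hpos _).ne' (hpos _).ne']
    split_ifs with hgrow
    · -- growth index: `χ(a m_{i+1}) ≤ D^J χ(a m_i)`
      rw [mul_one]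
      have h1 : χ (a * m (i + 1)) / χ (a * m i) ≤ D ^ J := by
        rw [div_le_iff₀ (hpos _), hmsucc]
        exact apply_two_pow_mul_le (zero_le_one.trans hD) hdouble J hami
      calc Real.log (χ (a * m (i + 1)) / χ (a * m i)) ≤ Real.log (D ^ J) :=
            Real.log_le_log (div_pos (hpos _) (hpos _)) h1
        _ = J * Real.log D := Real.log_pow D J
        _ ≤ J * Real.log D + Real.log 2 := le_add_of_nonneg_right (Real.log_nonneg one_le_two)
    · -- no growth: `χ(a m_{i+1}) < χ(a m_i) + χ(m_i) ≤ 2 χ(a m_i)`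
      rw [mul_zero, zero_add]
      push Not at hgrow
      have hle : χ (m i) ≤ χ (a * m i) := hmono (Nat.le_mul_of_pos_left _ (by omega))
      have h1 : χ (a * m (i + 1)) / χ (a * m i) ≤ 2 := by
        rw [div_le_iff₀ (hpos _)]
        linarith
      exact Real.log_le_log (div_pos (hpos _) (hpos _)) h1
  -- telescoping
  have htel : ∑ i ∈ Finset.range I, (g (i + 1) - g i) = g I - g 0 := Finset.sum_range_sub g I
  have hsum : g I - g 0 ≤ ∑ i ∈ Finset.range I,
      ((J * Real.log D) * (if χ (a * m i) + χ (m i) ≤ χ (a * m (i + 1)) then 1 else 0) + Real.log 2) := by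
    rw [← htel]
    exact Finset.sum_le_sum fun i _ => hstep i
  rw [Finset.sum_add_distrib, ← Finset.mul_sum, Finset.sum_boole, Finset.sum_const, Finset.card_range,
    nsmul_eq_mul] at hsum
  have h0 : g 0 = Real.log (χ (a * 2 ^ k₀)) := by simp [hg, hm]
  have hI : g I = Real.log (χ (a * 2 ^ (k₀ + I * J))) := by simp [hg, hm]
  rw [← h0, ← hI]
  convert hsum using 2

/-! ### Part D. The two-point function of the four-dimensional model at a growth scale

Throughout, `S = ⟨σ₀σ_x⟩^∅_β` on `ℤ⁴` (`twoPointFree 4 β`, `β ≥ 0`), `χ_t = ∑_{Λ_t} S`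
(`boxSusceptibility S t` at integer `t`), `e₁ = Pi.single 0 1`. A *growth scale* `m` for the
parameters `(a, r) = (32, r)` is one with `χ_{rm} ≥ χ_{32 m} + χ_m` (the printed `χ_{rm} ≥ χ_{4dm} + χ_m`,
with `4d = 16` replaced by `32` to give the comparability range the proof of P2 uses). -/

section Model

variable {β : ℝ}

/-- GKS I for the free two-point function: `0 ≤ ⟨σ₀σ_x⟩^∅_β` (`β ≥ 0`). [cite: FriedliVelenik2017, Theorem 3.20] -/
theorem twoPointFree_nonneg_of_nonneg (hβ : 0 ≤ β) (x : Site d) : 0 ≤ twoPointFree d β x :=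
  twoPointFree_nonneg hasBoxLimit_isingCorr_free_holds
    (fun {_ _ _ _ _} => GKSInequalities.gks_one_holds (zdGraph d)) hβ x

/-- **MMS, axis form**: `S(y) ≤ S(s e₁)` whenever `s ≤ ‖y‖_∞` (`S(y) ≤ S(‖y‖_∞ e₁)`,
`twoPointFree_le_axis_of_mem_sphere'`, and the axis values are non-increasing). [cite: MessagerMiracleSoleJSP1977, main theorem (monotonicity of ⟨σ₀σ_x⟩ under reflections)] -/
theorem twoPointFree_le_single_of_le (hβ : 0 ≤ β) (hd : 1 ≤ d) {y : Site d} {s : ℕ}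
    (hs : s ≤ Site.supNorm y) :
    twoPointFree d β y ≤ twoPointFree d β (Pi.single (⟨0, hd⟩ : Fin d) (s : ℤ)) := by
  refine (twoPointFree_le_axis_of_mem_sphere' hβ hd (self_mem_sphere y)).trans ?_
  obtain ⟨t, ht⟩ : ∃ t, Site.supNorm y = s + t := ⟨Site.supNorm y - s, by omega⟩
  have h := twoPointFree_add_single_le hβ (Pi.single (⟨0, hd⟩ : Fin d) (s : ℤ)) ⟨0, hd⟩ (by simp) t
  rw [← Pi.single_add] at h
  rw [ht]
  push_cast
  exact h

/-- **MMS, diagonal-axis form**: `S(s e₁) ≤ S(x)` whenever `d ‖x‖_∞ ≤ s`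
(`S(d ‖x‖_∞ e₁) ≤ S(x)`, `twoPointFree_diagAxis_le_of_mem_sphere'`, and the axis values are
non-increasing). [cite: MessagerMiracleSoleJSP1977, main theorem (monotonicity of ⟨σ₀σ_x⟩ under reflections)] -/
theorem twoPointFree_single_le_of_mul_le (hβ : 0 ≤ β) (hd : 1 ≤ d) {x : Site d} {s : ℕ}
    (hs : d * Site.supNorm x ≤ s) :
    twoPointFree d β (Pi.single (⟨0, hd⟩ : Fin d) (s : ℤ)) ≤ twoPointFree d β x := by
  refine le_trans ?_ (twoPointFree_diagAxis_le_of_mem_sphere' hβ hd (self_mem_sphere x))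
  obtain ⟨t, ht⟩ : ∃ t, s = d * Site.supNorm x + t := ⟨s - d * Site.supNorm x, by omega⟩
  have h := twoPointFree_add_single_le hβ
    (Pi.single (⟨0, hd⟩ : Fin d) ((d : ℤ) * Site.supNorm x)) ⟨0, hd⟩ (by simp; positivity) t
  rw [← Pi.single_add] at h
  rw [ht]
  push_cast
  exact h

/-- Shell sums at integer scales: `χ_b - χ_a = ∑_{Λ_b ∖ Λ_a} S` for `a ≤ b`. [folklore] -/
theorem boxSusceptibility_sub_eq_sum_sdiff (S : Site d → ℝ) {a b : ℕ} (hab : a ≤ b) :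
    boxSusceptibility S b - boxSusceptibility S a = ∑ x ∈ box d b \ box d a, S x := by
  rw [boxSusceptibility_natCast, boxSusceptibility_natCast,
    ← Finset.sum_sdiff (box_mono d hab), add_sub_cancel_right]

/-- **The lower reference value at a growth scale** (Aizenman–Duminil-Copin 2021, proof of Thm 5.12,
third display: "`|Ann(4dm, rm)| S(4dm e₁) ≥ χ_{rm} - χ_{4dm} ≥ χ_m`"): in `d = 4`, if
`χ_{rm} ≥ χ_{32m} + χ_m` then `χ_m ≤ (2rm+1)⁴ S(32 m e₁)`. [cite: AizenmanDuminilCopinAnnals2021, arXiv:1912.07973 proof of Theorem 5.12, third display (p. 20)] -/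
theorem boxSusceptibility_le_mul_single_of_growth (hβ : 0 ≤ β) {m r : ℕ} (hr : 32 ≤ r)
    (hG : boxSusceptibility (twoPointFree 4 β) ((32 * m : ℕ) : ℝ) + boxSusceptibility (twoPointFree 4 β) m ≤
      boxSusceptibility (twoPointFree 4 β) ((r * m : ℕ) : ℝ)) :
    boxSusceptibility (twoPointFree 4 β) m ≤
      (2 * (r : ℝ) * m + 1) ^ 4 * twoPointFree 4 β (Pi.single 0 ((32 * m : ℕ) : ℤ)) := by
  set S := twoPointFree 4 β with hS
  have h4 : (1 : ℕ) ≤ 4 := by norm_num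
  have hshell := boxSusceptibility_sub_eq_sum_sdiff S (show 32 * m ≤ r * m from Nat.mul_le_mul_right m hr)
  have hbound : ∑ x ∈ box 4 (r * m) \ box 4 (32 * m), S x ≤
      ∑ _x ∈ box 4 (r * m) \ box 4 (32 * m), S (Pi.single 0 ((32 * m : ℕ) : ℤ)) := by
    refine Finset.sum_le_sum fun x hx => ?_
    rw [Finset.mem_sdiff, mem_box_iff_supNorm_le, mem_box_iff_supNorm_le, not_le] at hx
    exact twoPointFree_le_single_of_le hβ h4 hx.2.le
  rw [Finset.sum_const, nsmul_eq_mul] at hbound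
  have hcard : (#(box 4 (r * m) \ box 4 (32 * m)) : ℝ) ≤ (2 * (r : ℝ) * m + 1) ^ 4 := by
    calc (#(box 4 (r * m) \ box 4 (32 * m)) : ℝ) ≤ #(box 4 (r * m)) := by
          exact_mod_cast Finset.card_le_card Finset.sdiff_subset
      _ = (2 * (r : ℝ) * m + 1) ^ 4 := by rw [card_box]; push_cast; ring
  have hS0 : 0 ≤ S (Pi.single 0 ((32 * m : ℕ) : ℤ)) := twoPointFree_nonneg_of_nonneg hβ _
  calc boxSusceptibility S m ≤ boxSusceptibility S ((r * m : ℕ) : ℝ) - boxSusceptibility S ((32 * m : ℕ) : ℝ) := by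
        linarith
    _ = ∑ x ∈ box 4 (r * m) \ box 4 (32 * m), S x := hshell
    _ ≤ #(box 4 (r * m) \ box 4 (32 * m)) * S (Pi.single 0 ((32 * m : ℕ) : ℤ)) := hbound
    _ ≤ (2 * (r : ℝ) * m + 1) ^ 4 * S (Pi.single 0 ((32 * m : ℕ) : ℤ)) :=
        mul_le_mul_of_nonneg_right hcard hS0

/-- **Lower bound on the scale**: at a growth scale (`χ_{rm} ≥ χ_{32m} + χ_m`, `d = 4`), every `z` with
`‖z‖_∞ ≤ 8m` has `S(z) ≥ S(32 m e₁) ≥ χ_m/(2rm+1)⁴` (MMS: `S(z) ≥ S(4‖z‖_∞ e₁)`). This is the printed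
"`S(x) ≥ S(4dm e₁) ≥ (c₃/m^d) χ_m`". [cite: AizenmanDuminilCopinAnnals2021, arXiv:1912.07973 proof of Theorem 5.12 (p. 20)] -/
theorem lower_ref_le_twoPointFree (hβ : 0 ≤ β) {m r : ℕ} (hr : 32 ≤ r)
    (hG : boxSusceptibility (twoPointFree 4 β) ((32 * m : ℕ) : ℝ) + boxSusceptibility (twoPointFree 4 β) m ≤
      boxSusceptibility (twoPointFree 4 β) ((r * m : ℕ) : ℝ))
    {z : Site 4} (hz : Site.supNorm z ≤ 8 * m) :
    boxSusceptibility (twoPointFree 4 β) m / (2 * (r : ℝ) * m + 1) ^ 4 ≤ twoPointFree 4 β z := by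
  have hpos : (0 : ℝ) < (2 * (r : ℝ) * m + 1) ^ 4 := by positivity
  rw [div_le_iff₀ hpos]
  calc boxSusceptibility (twoPointFree 4 β) m
      ≤ (2 * (r : ℝ) * m + 1) ^ 4 * twoPointFree 4 β (Pi.single 0 ((32 * m : ℕ) : ℤ)) :=
        boxSusceptibility_le_mul_single_of_growth hβ hr hG
    _ ≤ (2 * (r : ℝ) * m + 1) ^ 4 * twoPointFree 4 β z :=
        mul_le_mul_of_nonneg_left (twoPointFree_single_le_of_mul_le hβ (by norm_num) (by omega)) hpos.le
    _ = twoPointFree 4 β z * (2 * (r : ℝ) * m + 1) ^ 4 := mul_comm _ _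

/-- **Upper bound above the scale `m/16`** (`m = 64q`, `d = 4`): every `z` with `‖z‖_∞ ≥ 4q = m/16` has
`S(z) ≤ S(4q e₁) ≤ χ_m/(2q+1)⁴` (MMS: the `(2q+1)⁴` sites `v ∈ Λ_q` have `S(v) ≥ S(4‖v‖_∞ e₁) ≥ S(4q e₁)`,
and `∑_{Λ_q} S ≤ χ_m`). [cite: AizenmanDuminilCopinAnnals2021, arXiv:1912.07973 proof of Theorem 5.12 (p. 20)] -/
theorem twoPointFree_le_upper_ref (hβ : 0 ≤ β) (q : ℕ) {z : Site 4} (hz : 4 * q ≤ Site.supNorm z) :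
    twoPointFree 4 β z ≤ boxSusceptibility (twoPointFree 4 β) ((64 * q : ℕ) : ℝ) / (2 * (q : ℝ) + 1) ^ 4 := by
  set S := twoPointFree 4 β with hS
  have h4 : (1 : ℕ) ≤ 4 := by norm_num
  have hpos : (0 : ℝ) < (2 * (q : ℝ) + 1) ^ 4 := by positivity
  rw [le_div_iff₀ hpos]
  have h1 : S z ≤ S (Pi.single 0 ((4 * q : ℕ) : ℤ)) := twoPointFree_le_single_of_le hβ h4 hz
  have h2 : ∀ v ∈ box 4 q, S (Pi.single 0 ((4 * q : ℕ) : ℤ)) ≤ S v := fun v hv =>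
    twoPointFree_single_le_of_mul_le hβ h4 (by rw [mem_box_iff_supNorm_le] at hv; omega)
  have h3 : (#(box 4 q) : ℝ) * S (Pi.single 0 ((4 * q : ℕ) : ℤ)) ≤ ∑ v ∈ box 4 q, S v := by
    rw [← nsmul_eq_mul, ← Finset.sum_const]
    exact Finset.sum_le_sum h2
  have h4' : ∑ v ∈ box 4 q, S v ≤ boxSusceptibility S ((64 * q : ℕ) : ℝ) := by
    rw [boxSusceptibility_natCast]
    exact Finset.sum_le_sum_of_subset_of_nonneg (box_mono 4 (by omega))
      fun v _ _ => twoPointFree_nonneg_of_nonneg hβ v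
  have hcard : (#(box 4 q) : ℝ) = (2 * (q : ℝ) + 1) ^ 4 := by rw [card_box]; push_cast; ring
  calc S z * (2 * (q : ℝ) + 1) ^ 4 ≤ S (Pi.single 0 ((4 * q : ℕ) : ℤ)) * (2 * (q : ℝ) + 1) ^ 4 :=
        mul_le_mul_of_nonneg_right h1 hpos.le
    _ = (#(box 4 q) : ℝ) * S (Pi.single 0 ((4 * q : ℕ) : ℤ)) := by rw [hcard, mul_comm]
    _ ≤ boxSusceptibility S ((64 * q : ℕ) : ℝ) := h3.trans h4'

/-- **The ratio of the two reference values**: `(2rm+1)⁴/(2q+1)⁴ ≤ (64 r)⁴` for `m = 64 q`, `q ≥ 1`,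
so that on `{m/16 ≤ ‖z‖_∞ ≤ 8m}` the two-point function at a growth scale varies by at most the factor
`Θ = (64r)⁴`. [folklore] -/
theorem ref_ratio_le {q r : ℕ} (hq : 1 ≤ q) (hr : 1 ≤ r) :
    (2 * (r : ℝ) * ((64 * q : ℕ) : ℝ) + 1) ^ 4 / (2 * (q : ℝ) + 1) ^ 4 ≤ (64 * (r : ℝ)) ^ 4 := by
  have hpos : (0 : ℝ) < (2 * (q : ℝ) + 1) ^ 4 := by positivity
  rw [div_le_iff₀ hpos, ← mul_pow]
  apply pow_le_pow_left₀ (by positivity)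
  have hq' : (1 : ℝ) ≤ q := by exact_mod_cast hq
  have hr' : (1 : ℝ) ≤ r := by exact_mod_cast hr
  push_cast
  nlinarith

/-- **Comparability at a growth scale**: for `m = 64q` (`q ≥ 1`) with `χ_{rm} ≥ χ_{32m} + χ_m` (`r ≥ 32`),
all `x, z` with `‖x‖_∞ ≤ 8m` and `‖z‖_∞ ≥ m/16` satisfy `S(z) ≤ (64r)⁴ S(x)` — the source of P1 and of the
constants in P2–P4. [cite: AizenmanDuminilCopinAnnals2021, arXiv:1912.07973 proof of Theorem 5.12 ("This implies … which immediately gives P1", p. 20)] -/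
theorem twoPointFree_le_mul_of_growth (hβ : 0 ≤ β) {q r : ℕ} (hq : 1 ≤ q) (hr : 32 ≤ r)
    (hG : boxSusceptibility (twoPointFree 4 β) ((32 * (64 * q) : ℕ) : ℝ) +
        boxSusceptibility (twoPointFree 4 β) ((64 * q : ℕ) : ℝ) ≤
      boxSusceptibility (twoPointFree 4 β) ((r * (64 * q) : ℕ) : ℝ))
    {x z : Site 4} (hx : Site.supNorm x ≤ 8 * (64 * q)) (hz : 4 * q ≤ Site.supNorm z) :
    twoPointFree 4 β z ≤ (64 * (r : ℝ)) ^ 4 * twoPointFree 4 β x := by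
  have hlo := lower_ref_le_twoPointFree hβ hr hG hx
  have hup := twoPointFree_le_upper_ref hβ q hz
  have hratio := ref_ratio_le hq (by omega : 1 ≤ r)
  have hχ0 : 0 ≤ boxSusceptibility (twoPointFree 4 β) ((64 * q : ℕ) : ℝ) :=
    boxSusceptibility_nonneg (twoPointFree_nonneg_of_nonneg hβ) _
  have hA : (0 : ℝ) < (2 * (r : ℝ) * ((64 * q : ℕ) : ℝ) + 1) ^ 4 := by positivity
  have hB : (0 : ℝ) < (2 * (q : ℝ) + 1) ^ 4 := by positivity
  -- `χ/B ≤ (A/B) · (χ/A) ≤ Θ · S(x)`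
  calc twoPointFree 4 β z ≤ boxSusceptibility (twoPointFree 4 β) ((64 * q : ℕ) : ℝ) / (2 * (q : ℝ) + 1) ^ 4 := hup
    _ = (2 * (r : ℝ) * ((64 * q : ℕ) : ℝ) + 1) ^ 4 / (2 * (q : ℝ) + 1) ^ 4 *
          (boxSusceptibility (twoPointFree 4 β) ((64 * q : ℕ) : ℝ) /
            (2 * (r : ℝ) * ((64 * q : ℕ) : ℝ) + 1) ^ 4) := by
        field_simp
    _ ≤ (64 * (r : ℝ)) ^ 4 * twoPointFree 4 β x :=
        mul_le_mul hratio hlo (div_nonneg hχ0 hA.le) (by positivity)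


/-- **P1 at a growth scale** (`m = 64q`, `d = 4`): `S(y) ≤ (64r)⁴ S(x)` for all `x, y ∈ Ann(m/2, 4m)`.
[cite: AizenmanDuminilCopinAnnals2021, arXiv:1912.07973 proof of Theorem 5.12 (P1, p. 20)] -/
theorem p1_of_growth (hβ : 0 ≤ β) {q r : ℕ} (hq : 1 ≤ q) (hr : 32 ≤ r)
    (hG : boxSusceptibility (twoPointFree 4 β) ((32 * (64 * q) : ℕ) : ℝ) +
        boxSusceptibility (twoPointFree 4 β) ((64 * q : ℕ) : ℝ) ≤
      boxSusceptibility (twoPointFree 4 β) ((r * (64 * q) : ℕ) : ℝ)) :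
    ∀ x ∈ ann 4 (64 * q / 2) (4 * (64 * q)), ∀ y ∈ ann 4 (64 * q / 2) (4 * (64 * q)),
      twoPointFree 4 β y ≤ (64 * (r : ℝ)) ^ 4 * twoPointFree 4 β x := by
  intro x hx y hy
  rw [mem_ann] at hx hy
  exact twoPointFree_le_mul_of_growth hβ hq hr hG (by omega) (by omega)

/-- `|Λ_{2m} ∖ Λ_m|` is at least half of `|Λ_{2m}|`… in the form needed:
`(2rm+1)⁴ ≤ 2 r⁴ (|Λ_{2m}| - |Λ_m|)` for `m, r ≥ 1` (`d = 4`). [folklore] -/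
theorem shell_card_bound {m r : ℕ} (hm : 1 ≤ m) (hr : 1 ≤ r) :
    (2 * (r : ℝ) * m + 1) ^ 4 ≤ 2 * (r : ℝ) ^ 4 * ((#(box 4 (2 * m)) : ℝ) - #(box 4 m)) := by
  rw [card_box, card_box]
  push_cast
  have hm' : (1 : ℝ) ≤ m := by exact_mod_cast hm
  have hr' : (1 : ℝ) ≤ r := by exact_mod_cast hr
  -- `2rm + 1 ≤ r (2m+1)` and `81 (4m+1)⁴ ≥ 625 (2m+1)⁴`
  have h1 : (2 * (r : ℝ) * m + 1) ^ 4 ≤ ((r : ℝ) * (2 * m + 1)) ^ 4 :=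
    pow_le_pow_left₀ (by positivity) (by nlinarith) 4
  have h2 : (5 * (2 * (m : ℝ) + 1)) ^ 4 ≤ (3 * (2 * (2 * (m : ℝ)) + 1)) ^ 4 :=
    pow_le_pow_left₀ (by positivity) (by nlinarith) 4
  rw [mul_pow] at h1
  rw [mul_pow, mul_pow] at h2
  have hr4 : (0 : ℝ) ≤ (r : ℝ) ^ 4 := by positivity
  have h4 := mul_le_mul_of_nonneg_left h2 hr4
  norm_num at h4
  have hX : (0 : ℝ) ≤ (r : ℝ) ^ 4 * (2 * (m : ℝ) + 1) ^ 4 := by positivity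
  nlinarith [h1, h4, hX]

/-- **P4 at a growth scale** (`m = 64q`, `d = 4`): `χ_{2m} ≥ (1 + 1/(2r⁴)) χ_m`, since the
`|Λ_{2m} ∖ Λ_m|` sites of the shell all have `S ≥ χ_m/(2rm+1)⁴`. (Printed: "the fact that
`S(x) ≥ S(4dm e₁) ≥ (c₃/m^d) χ_m` for every `x ∈ Ann(m, 2m)` implies P4".) [cite: AizenmanDuminilCopinAnnals2021, arXiv:1912.07973 proof of Theorem 5.12 (P4, p. 20)] -/
theorem p4_of_growth (hβ : 0 ≤ β) {q r : ℕ} (hq : 1 ≤ q) (hr : 32 ≤ r)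
    (hG : boxSusceptibility (twoPointFree 4 β) ((32 * (64 * q) : ℕ) : ℝ) +
        boxSusceptibility (twoPointFree 4 β) ((64 * q : ℕ) : ℝ) ≤
      boxSusceptibility (twoPointFree 4 β) ((r * (64 * q) : ℕ) : ℝ)) :
    (1 + 1 / (2 * (r : ℝ) ^ 4)) * boxSusceptibility (twoPointFree 4 β) ((64 * q : ℕ) : ℝ) ≤
      boxSusceptibility (twoPointFree 4 β) ((2 * (64 * q) : ℕ) : ℝ) := by
  set S := twoPointFree 4 β with hS
  set m : ℕ := 64 * q with hm
  have hm1 : 1 ≤ m := by omega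
  have hr1 : 1 ≤ r := by omega
  set A : ℝ := (2 * (r : ℝ) * m + 1) ^ 4 with hA
  have hApos : 0 < A := by positivity
  have hχ0 : 0 ≤ boxSusceptibility S (m : ℝ) := boxSusceptibility_nonneg (twoPointFree_nonneg_of_nonneg hβ) _
  -- the shell sum
  have hshell := boxSusceptibility_sub_eq_sum_sdiff S (show m ≤ 2 * m by omega)
  have hlo : ∀ z ∈ box 4 (2 * m) \ box 4 m, boxSusceptibility S (m : ℝ) / A ≤ S z := by
    intro z hz
    have hz' : Site.supNorm z ≤ 8 * m := by
      have := mem_box_iff_supNorm_le.1 (Finset.mem_sdiff.1 hz).1; omega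
    exact lower_ref_le_twoPointFree hβ hr hG hz'
  have hsum : (#(box 4 (2 * m) \ box 4 m) : ℝ) * (boxSusceptibility S (m : ℝ) / A) ≤
      ∑ z ∈ box 4 (2 * m) \ box 4 m, S z := by
    rw [← nsmul_eq_mul, ← Finset.sum_const]
    exact Finset.sum_le_sum hlo
  have hcard : (#(box 4 (2 * m) \ box 4 m) : ℝ) = (#(box 4 (2 * m)) : ℝ) - #(box 4 m) := by
    have h := Finset.card_sdiff_add_card_eq_card (box_mono 4 (show m ≤ 2 * m by omega))
    have h' : (#(box 4 (2 * m) \ box 4 m) : ℝ) + #(box 4 m) = #(box 4 (2 * m)) := by exact_mod_cast h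
    linarith
  have hnum := shell_card_bound hm1 hr1
  -- `χ_m / (2r⁴) ≤ (|Λ_{2m}| - |Λ_m|) χ_m / A ≤ χ_{2m} - χ_m`
  have key : boxSusceptibility S (m : ℝ) / (2 * (r : ℝ) ^ 4) ≤
      boxSusceptibility S ((2 * m : ℕ) : ℝ) - boxSusceptibility S (m : ℝ) := by
    rw [hshell]
    refine le_trans ?_ hsum
    rw [hcard, div_le_iff₀ (by positivity : (0 : ℝ) < 2 * (r : ℝ) ^ 4)]
    calc boxSusceptibility S (m : ℝ) = A * (boxSusceptibility S (m : ℝ) / A) := by field_simp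
      _ ≤ (2 * (r : ℝ) ^ 4 * ((#(box 4 (2 * m)) : ℝ) - #(box 4 m))) * (boxSusceptibility S (m : ℝ) / A) :=
          mul_le_mul_of_nonneg_right hnum (div_nonneg hχ0 hApos.le)
      _ = ((#(box 4 (2 * m)) : ℝ) - #(box 4 m)) * (boxSusceptibility S (m : ℝ) / A) * (2 * (r : ℝ) ^ 4) := by
          ring
  have hcast : ((64 * q : ℕ) : ℝ) = (m : ℝ) := by rw [hm]
  have hcast2 : ((2 * (64 * q) : ℕ) : ℝ) = ((2 * m : ℕ) : ℝ) := by rw [hm]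
  rw [hcast, hcast2, add_mul, one_mul, one_div, inv_mul_eq_div]
  linarith

/-- **P3 at a growth scale** (`m = 64q`, `d = 4`): if `χ_{Rm} ≤ K R² χ_m` (the sliding-scale infrared
bound between the scales `m` and `Rm`, ADC Thm 5.6) with `8R² ≥ 81 K r⁴`, then `S(y) ≤ S(x)/2` for all
`x ∈ Λ_m` and all `y ∉ Λ_{4Rm}`: "`|Λ_{Rm}| S(y) ≤ χ_{Rm} ≤ C₄R²χ_m ≤ C₅R²m^d S(x)`".
[cite: AizenmanDuminilCopinAnnals2021, arXiv:1912.07973 proof of Theorem 5.12 (P3, last display, p. 20)] -/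
theorem p3_of_growth (hβ : 0 ≤ β) {q r R : ℕ} (hq : 1 ≤ q) (hr : 32 ≤ r) (hR : 1 ≤ R)
    (hG : boxSusceptibility (twoPointFree 4 β) ((32 * (64 * q) : ℕ) : ℝ) +
        boxSusceptibility (twoPointFree 4 β) ((64 * q : ℕ) : ℝ) ≤
      boxSusceptibility (twoPointFree 4 β) ((r * (64 * q) : ℕ) : ℝ))
    {K : ℝ} (hK0 : 0 ≤ K)
    (hK : boxSusceptibility (twoPointFree 4 β) ((R * (64 * q) : ℕ) : ℝ) ≤
      K * (R : ℝ) ^ 2 * boxSusceptibility (twoPointFree 4 β) ((64 * q : ℕ) : ℝ))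
    (hRK : 81 * K * (r : ℝ) ^ 4 ≤ 8 * (R : ℝ) ^ 2) :
    ∀ x ∈ box 4 (64 * q), ∀ y : Site 4, (4 * R : ℝ) * ((64 * q : ℕ) : ℝ) < Site.supNorm y →
      twoPointFree 4 β y ≤ twoPointFree 4 β x / 2 := by
  intro x hx y hy
  set S := twoPointFree 4 β with hS
  set m : ℕ := 64 * q with hm
  have hm1 : 1 ≤ m := by omega
  have h4 : (1 : ℕ) ≤ 4 := by norm_num
  -- `‖y‖_∞ ≥ 4Rm + 1`
  have hy' : 4 * R * m ≤ Site.supNorm y := by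
    have : ((4 * R * m : ℕ) : ℝ) < Site.supNorm y := by push_cast; linarith
    exact_mod_cast this.le
  -- `S(y) ≤ S(4Rm e₁) ≤ S(v)` for every `v ∈ Λ_{Rm}`
  have hSy : ∀ v ∈ box 4 (R * m), S y ≤ S v := fun v hv =>
    (twoPointFree_le_single_of_le hβ h4 hy').trans
      (twoPointFree_single_le_of_mul_le hβ h4 (by rw [mem_box_iff_supNorm_le] at hv; rw [Nat.mul_assoc]; omega))
  have h1 : (#(box 4 (R * m)) : ℝ) * S y ≤ boxSusceptibility S ((R * m : ℕ) : ℝ) := by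
    rw [boxSusceptibility_natCast, ← nsmul_eq_mul, ← Finset.sum_const]
    exact Finset.sum_le_sum hSy
  -- `χ_m ≤ (2rm+1)⁴ S(32 m e₁) ≤ (2rm+1)⁴ S(x)`
  have h2 : boxSusceptibility S (m : ℝ) ≤ (2 * (r : ℝ) * m + 1) ^ 4 * S x := by
    refine (boxSusceptibility_le_mul_single_of_growth hβ hr hG).trans ?_
    refine mul_le_mul_of_nonneg_left ?_ (by positivity)
    exact twoPointFree_single_le_of_mul_le hβ h4 (by rw [mem_box_iff_supNorm_le] at hx; omega)
  have hcast : ((64 * q : ℕ) : ℝ) = (m : ℝ) := by rw [hm]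
  have hcastR : ((R * (64 * q) : ℕ) : ℝ) = ((R * m : ℕ) : ℝ) := by rw [hm]
  rw [hcast, hcastR] at hK
  have hcard : (#(box 4 (R * m)) : ℝ) = (2 * (R : ℝ) * m + 1) ^ 4 := by rw [card_box]; push_cast; ring
  have hSx : 0 ≤ S x := twoPointFree_nonneg_of_nonneg hβ x
  have hSy0 : 0 ≤ S y := twoPointFree_nonneg_of_nonneg hβ y
  -- combine: `(2Rm+1)⁴ S(y) ≤ K R² (2rm+1)⁴ S(x)`
  have key : (2 * (R : ℝ) * m + 1) ^ 4 * S y ≤ K * (R : ℝ) ^ 2 * ((2 * (r : ℝ) * m + 1) ^ 4 * S x) := by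
    rw [← hcard]
    exact h1.trans (hK.trans (mul_le_mul_of_nonneg_left h2 (by positivity)))
  -- numerics: `(2rm+1)⁴ ≤ 81 r⁴ m⁴`, `16 R⁴ m⁴ ≤ (2Rm+1)⁴`
  have hm' : (1 : ℝ) ≤ m := by exact_mod_cast hm1
  have hR' : (1 : ℝ) ≤ R := by exact_mod_cast hR
  have hr' : (32 : ℝ) ≤ r := by exact_mod_cast hr
  have hup : (2 * (r : ℝ) * m + 1) ^ 4 ≤ 81 * (r : ℝ) ^ 4 * (m : ℝ) ^ 4 := by
    have : (2 * (r : ℝ) * m + 1) ≤ 3 * (r * m) := by nlinarith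
    calc (2 * (r : ℝ) * m + 1) ^ 4 ≤ (3 * ((r : ℝ) * m)) ^ 4 := pow_le_pow_left₀ (by positivity) this 4
      _ = 81 * (r : ℝ) ^ 4 * (m : ℝ) ^ 4 := by ring
  have hdown : 16 * (R : ℝ) ^ 4 * (m : ℝ) ^ 4 ≤ (2 * (R : ℝ) * m + 1) ^ 4 := by
    calc 16 * (R : ℝ) ^ 4 * (m : ℝ) ^ 4 = (2 * ((R : ℝ) * m)) ^ 4 := by ring
      _ ≤ (2 * (R : ℝ) * m + 1) ^ 4 := pow_le_pow_left₀ (by positivity) (by nlinarith) 4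
  have hRm : (0 : ℝ) < (R : ℝ) ^ 4 * (m : ℝ) ^ 4 := by positivity
  have key2 : 16 * ((R : ℝ) ^ 4 * (m : ℝ) ^ 4) * S y ≤ 8 * ((R : ℝ) ^ 4 * (m : ℝ) ^ 4) * S x := by
    calc 16 * ((R : ℝ) ^ 4 * (m : ℝ) ^ 4) * S y = (16 * (R : ℝ) ^ 4 * (m : ℝ) ^ 4) * S y := by ring
      _ ≤ (2 * (R : ℝ) * m + 1) ^ 4 * S y := mul_le_mul_of_nonneg_right hdown hSy0
      _ ≤ K * (R : ℝ) ^ 2 * ((2 * (r : ℝ) * m + 1) ^ 4 * S x) := key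
      _ ≤ K * (R : ℝ) ^ 2 * ((81 * (r : ℝ) ^ 4 * (m : ℝ) ^ 4) * S x) :=
          mul_le_mul_of_nonneg_left (mul_le_mul_of_nonneg_right hup hSx) (by positivity)
      _ = (81 * K * (r : ℝ) ^ 4) * ((R : ℝ) ^ 2 * (m : ℝ) ^ 4 * S x) := by ring
      _ ≤ (8 * (R : ℝ) ^ 2) * ((R : ℝ) ^ 2 * (m : ℝ) ^ 4 * S x) :=
          mul_le_mul_of_nonneg_right hRK (by positivity)
      _ = 8 * ((R : ℝ) ^ 4 * (m : ℝ) ^ 4) * S x := by ring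
  have key3 : ((R : ℝ) ^ 4 * (m : ℝ) ^ 4) * (16 * S y) ≤ ((R : ℝ) ^ 4 * (m : ℝ) ^ 4) * (8 * S x) := by
    linarith [key2]
  have : 16 * S y ≤ 8 * S x := le_of_mul_le_mul_left key3 hRm
  linarith


/-! #### P2: single steps -/

/-- The upper reference value is within the factor `Θ = (64r)⁴` of `S(x)` for `‖x‖_∞ ≤ 8m`
(`m = 64q`, growth scale). [cite: AizenmanDuminilCopinAnnals2021, arXiv:1912.07973 proof of Theorem 5.12 (p. 20)] -/
theorem upper_ref_le_mul_of_growth (hβ : 0 ≤ β) {q r : ℕ} (hq : 1 ≤ q) (hr : 32 ≤ r)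
    (hG : boxSusceptibility (twoPointFree 4 β) ((32 * (64 * q) : ℕ) : ℝ) +
        boxSusceptibility (twoPointFree 4 β) ((64 * q : ℕ) : ℝ) ≤
      boxSusceptibility (twoPointFree 4 β) ((r * (64 * q) : ℕ) : ℝ))
    {x : Site 4} (hx : Site.supNorm x ≤ 8 * (64 * q)) :
    boxSusceptibility (twoPointFree 4 β) ((64 * q : ℕ) : ℝ) / (2 * (q : ℝ) + 1) ^ 4 ≤
      (64 * (r : ℝ)) ^ 4 * twoPointFree 4 β x := by
  have hlo := lower_ref_le_twoPointFree hβ hr hG hx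
  have hratio := ref_ratio_le hq (by omega : 1 ≤ r)
  have hχ0 : 0 ≤ boxSusceptibility (twoPointFree 4 β) ((64 * q : ℕ) : ℝ) :=
    boxSusceptibility_nonneg (twoPointFree_nonneg_of_nonneg hβ) _
  have hA : (0 : ℝ) < (2 * (r : ℝ) * ((64 * q : ℕ) : ℝ) + 1) ^ 4 := by positivity
  have hB : (0 : ℝ) < (2 * (q : ℝ) + 1) ^ 4 := by positivity
  calc boxSusceptibility (twoPointFree 4 β) ((64 * q : ℕ) : ℝ) / (2 * (q : ℝ) + 1) ^ 4
      = (2 * (r : ℝ) * ((64 * q : ℕ) : ℝ) + 1) ^ 4 / (2 * (q : ℝ) + 1) ^ 4 *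
          (boxSusceptibility (twoPointFree 4 β) ((64 * q : ℕ) : ℝ) /
            (2 * (r : ℝ) * ((64 * q : ℕ) : ℝ) + 1) ^ 4) := by
        field_simp
    _ ≤ (64 * (r : ℝ)) ^ 4 * twoPointFree 4 β x :=
        mul_le_mul hratio hlo (div_nonneg hχ0 hA.le) (by positivity)

/-- **One gradient step along a large coordinate** (Duminil-Copin–Panis form of ADC Prop. 5.9,
`twoPointFree_gradient_estimate`, with `j = 4q = m/16`): for `m*(β) = 0`, `wᵢ ≥ 8q` and `m = 64q`,
`0 ≤ S(w) - S(w + eᵢ) ≤ Up/(4q+1)` where `Up = χ_m/(2q+1)⁴ ≥ S(4q eᵢ)`.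
[cite: AizenmanDuminilCopinAnnals2021, arXiv:1912.07973 Proposition 5.9 and proof of Theorem 5.12 (P2, p. 20)] [cite: DuminilCopinPanis2025LowerBounds, eq. (1.11)] -/
theorem dcp_step (hβ : 0 ≤ β) (hm0 : spontaneousMagnetization 4 β = 0) (q : ℕ) {w : Site 4} {i : Fin 4}
    (hwi : ((8 * q : ℕ) : ℤ) ≤ w i) :
    0 ≤ twoPointFree 4 β w - twoPointFree 4 β (w + Pi.single i 1) ∧
      twoPointFree 4 β w - twoPointFree 4 β (w + Pi.single i 1) ≤
        boxSusceptibility (twoPointFree 4 β) ((64 * q : ℕ) : ℝ) / (2 * (q : ℝ) + 1) ^ 4 / (4 * (q : ℝ) + 1) := by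
  set S := twoPointFree 4 β with hS
  constructor
  · have h := messager_miracleSole_free hβ w i (by omega)
    linarith
  · have hdcp := twoPointFree_gradient_estimate hβ hm0 i w (4 * q) (by push_cast; omega)
    refine hdcp.trans ?_
    have hnum : S (Pi.single i ((4 * q : ℕ) : ℤ)) ≤
        boxSusceptibility S ((64 * q : ℕ) : ℝ) / (2 * (q : ℝ) + 1) ^ 4 := by
      rw [hS, twoPointFree_single_eq_single hβ i 0]
      exact twoPointFree_le_upper_ref hβ q (by rw [Site.supNorm_single]; omega)
    have hden : (4 * (q : ℝ) + 1) ≤ (w i : ℝ) - ((4 * q : ℕ) : ℝ) + 1 := by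
      have : ((8 * q : ℕ) : ℝ) ≤ (w i : ℝ) := by exact_mod_cast hwi
      push_cast at this ⊢
      linarith
    have hden0 : (0 : ℝ) < 4 * (q : ℝ) + 1 := by positivity
    have hnum0 : 0 ≤ S (Pi.single i ((4 * q : ℕ) : ℤ)) := twoPointFree_nonneg_of_nonneg hβ _
    calc S (Pi.single i ((4 * q : ℕ) : ℤ)) / ((w i : ℝ) - ((4 * q : ℕ) : ℝ) + 1)
        ≤ S (Pi.single i ((4 * q : ℕ) : ℤ)) / (4 * (q : ℝ) + 1) :=
          div_le_div_of_nonneg_left hnum0 hden0 hden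
      _ ≤ _ := div_le_div_of_nonneg_right hnum hden0.le

/-- Coordinates of a reflected site. [folklore] -/
theorem Site.update_neg_apply (w : Site d) (i j : Fin d) :
    Function.update w i (-w i) j = if j = i then -w j else w j := by
  by_cases h : j = i
  · subst h; simp
  · simp [h]

/-- The sup norm is invariant under a coordinate reflection. [folklore] -/
theorem Site.supNorm_update_neg (w : Site d) (i : Fin d) :
    Site.supNorm (Function.update w i (-w i)) = Site.supNorm w := by
  unfold Site.supNorm
  congr 1
  funext j
  rw [Site.update_neg_apply]
  split_ifs <;> simp

/-- **Two-sided control of a step in a small coordinate** (the "Messager–Miracle-Solé inequality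
applied twice" of the proof of ADC Prop. 5.9, case `i ≠ 1`): if `0 ≤ wᵢ`, `wᵢ + 1 ≤ w_{i₀}` for another
index `i₀` with `w_{i₀} - 1 ≥ 8q` (`m = 64q`, `m*(β) = 0`), then
`S(w + e_{i₀}) ≤ S(w + eᵢ) ≤ S(w - e_{i₀})` and `S(w + e_{i₀}) ≤ S(w) ≤ S(w - e_{i₀})`, whence
`|S(w + eᵢ) - S(w)| ≤ Up/(4q+1)` by two gradient steps along `i₀`.
[cite: AizenmanDuminilCopinAnnals2021, arXiv:1912.07973 proof of Proposition 5.9 ("use the Messager-Miracle-Sole inequality applied twice", p. 19)] -/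
theorem two_sided_step (hβ : 0 ≤ β) (hm0 : spontaneousMagnetization 4 β = 0) (q : ℕ) {w : Site 4}
    {i i₀ : Fin 4} (hii : i₀ ≠ i) (hwi : 0 ≤ w i) (hwi' : w i + 1 ≤ w i₀)
    (hbig : ((8 * q : ℕ) : ℤ) ≤ w i₀ - 1) :
    |twoPointFree 4 β (w + Pi.single i 1) - twoPointFree 4 β w| ≤
      boxSusceptibility (twoPointFree 4 β) ((64 * q : ℕ) : ℝ) / (2 * (q : ℝ) + 1) ^ 4 / (4 * (q : ℝ) + 1) := by
  set S := twoPointFree 4 β with hS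
  -- a1: `S(w + e_{i₀}) ≤ S(w + eᵢ)`
  have a1 : S (w + Pi.single i₀ 1) ≤ S (w + Pi.single i 1) := by
    have h := messager_miracleSole_diag_free hβ (w + Pi.single i 1) hii (by simp [hii]; omega)
    have heq : w + Pi.single i 1 + Pi.single i₀ 1 - Pi.single i 1 = w + Pi.single i₀ 1 := by abel
    rw [heq] at h
    exact h
  -- a2: `S(w + eᵢ) ≤ S(w - e_{i₀})` (reflect the `i`-th coordinate)
  have a2 : S (w + Pi.single i 1) ≤ S (w - Pi.single i₀ 1) := by
    set u : Site 4 := Function.update w i (-w i) - Pi.single i₀ 1 with hu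
    have hui : u i = -w i := by simp [hu, hii]
    have hui₀ : u i₀ = w i₀ - 1 := by simp [hu, hii]
    have h := messager_miracleSole_diag_free hβ u hii (by rw [hui, hui₀]; omega)
    have heq1 : u + Pi.single i₀ 1 - Pi.single i 1 =
        Function.update (w + Pi.single i 1) i (-(w + Pi.single i 1 : Site 4) i) := by
      funext j
      simp only [hu, Pi.add_apply, Pi.sub_apply, Site.update_neg_apply]
      by_cases hj : j = i
      · subst hj; simp [Ne.symm hii]; ring
      · by_cases hj' : j = i₀
        · subst hj'; simp [hj]
        · simp [hj, hj']
    have heq2 : u = Function.update (w - Pi.single i₀ 1) i (-(w - Pi.single i₀ 1 : Site 4) i) := by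
      funext j
      simp only [hu, Pi.sub_apply, Site.update_neg_apply]
      by_cases hj : j = i
      · subst hj; simp [Ne.symm hii]
      · simp [hj]
    rw [heq1, twoPointFree_reflection hβ, heq2, twoPointFree_reflection hβ] at h
    exact h
  -- a3: axis monotonicity at `w` and `w - e_{i₀}`
  have hw0 : 0 ≤ w i₀ := by omega
  have a3 : S (w + Pi.single i₀ 1) ≤ S w := messager_miracleSole_free hβ w i₀ hw0
  have a3' : S w ≤ S (w - Pi.single i₀ 1) := by
    have h := messager_miracleSole_free hβ (w - Pi.single i₀ 1) i₀ (by simp; omega)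
    rw [sub_add_cancel] at h
    exact h
  -- a4: two gradient steps along `i₀`
  have d1 := (dcp_step hβ hm0 q (w := w) (i := i₀) (by omega)).2
  have d2' := dcp_step hβ hm0 q (w := w - Pi.single i₀ 1) (i := i₀) (by simp; omega)
  rw [sub_add_cancel] at d2'
  have d2 := d2'.2
  rw [abs_le]
  constructor <;> linarith

/-- **The single-step bound at points with a non-negative step coordinate**: for `m = 64q` (`q ≥ 1`),
`m*(β) = 0`, every `w` with `‖w‖_∞ ≥ 16q - 1` and `wᵢ ≥ 0` satisfies `|S(w + eᵢ) - S(w)| ≤ Up/(4q+1)`: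
either `wᵢ ≥ 8q` (one gradient step) or a largest coordinate `i₀ ≠ i` is available for `two_sided_step`
(after a reflection making it positive). [cite: AizenmanDuminilCopinAnnals2021, arXiv:1912.07973 proof of Proposition 5.9 and of Theorem 5.12 (P2)] -/
theorem step_bound_of_nonneg (hβ : 0 ≤ β) (hm0 : spontaneousMagnetization 4 β = 0) {q : ℕ} (hq : 1 ≤ q)
    {w : Site 4} (hw : 16 * q - 1 ≤ Site.supNorm w) {i : Fin 4} (hwi : 0 ≤ w i) :
    |twoPointFree 4 β (w + Pi.single i 1) - twoPointFree 4 β w| ≤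
      boxSusceptibility (twoPointFree 4 β) ((64 * q : ℕ) : ℝ) / (2 * (q : ℝ) + 1) ^ 4 / (4 * (q : ℝ) + 1) := by
  set S := twoPointFree 4 β with hS
  by_cases hlarge : ((8 * q : ℕ) : ℤ) ≤ w i
  · obtain ⟨h0, h1⟩ := dcp_step hβ hm0 q (w := w) (i := i) hlarge
    rw [abs_sub_comm, abs_of_nonneg h0]
    exact h1
  · push Not at hlarge
    obtain ⟨i₀, hi₀⟩ := Site.exists_natAbs_eq_supNorm ⟨0, Finset.mem_univ _⟩ w
    have hbig : 8 * q + 2 ≤ (w i₀).natAbs := by rw [hi₀]; omega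
    have hii : i₀ ≠ i := by
      rintro rfl
      omega
    rcases lt_or_gt_of_ne (show w i₀ ≠ 0 by omega) with hneg | hposw
    · -- reflect the `i₀`-th coordinate
      set w' : Site 4 := Function.update w i₀ (-w i₀) with hw'
      have hw'i₀ : w' i₀ = -w i₀ := by simp [hw']
      have hw'i : w' i = w i := by simp [hw', Ne.symm hii]
      have h := two_sided_step hβ hm0 q (w := w') hii (by rw [hw'i]; exact hwi)
        (by rw [hw'i, hw'i₀]; omega) (by rw [hw'i₀]; omega)
      have heq1 : w' + Pi.single i 1 = Function.update (w + Pi.single i 1) i₀ (-(w + Pi.single i 1 : Site 4) i₀) := by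
        funext j
        simp only [hw', Pi.add_apply, Site.update_neg_apply]
        by_cases hj : j = i₀
        · subst hj; simp [hii]
        · simp [hj]
      rw [heq1, twoPointFree_reflection hβ, hw', twoPointFree_reflection hβ] at h
      exact h
    · exact two_sided_step hβ hm0 q hii hwi (by omega) (by omega)

/-- **The single-step bound** (`m = 64q`, `q ≥ 1`, `m*(β) = 0`): for every `z` with `‖z‖_∞ ≥ 16q = m/4` and
every direction `i`, `|S(z + eᵢ) - S(z)| ≤ Up/(4q+1)`, `Up = χ_m/(2q+1)⁴` (if `zᵢ < 0`, reflect the `i`-th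
coordinate of `z + eᵢ`). [cite: AizenmanDuminilCopinAnnals2021, arXiv:1912.07973 proof of Theorem 5.12 (P2 "by the gradient estimate given by Proposition 5.9", p. 20)] -/
theorem step_bound (hβ : 0 ≤ β) (hm0 : spontaneousMagnetization 4 β = 0) {q : ℕ} (hq : 1 ≤ q)
    {z : Site 4} (hz : 16 * q ≤ Site.supNorm z) (i : Fin 4) :
    |twoPointFree 4 β (z + Pi.single i 1) - twoPointFree 4 β z| ≤
      boxSusceptibility (twoPointFree 4 β) ((64 * q : ℕ) : ℝ) / (2 * (q : ℝ) + 1) ^ 4 / (4 * (q : ℝ) + 1) := by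
  rcases le_or_gt 0 (z i) with hzi | hzi
  · exact step_bound_of_nonneg hβ hm0 hq (by omega) hzi
  · set w : Site 4 := Function.update (z + Pi.single i 1) i (-(z + Pi.single i 1 : Site 4) i) with hw
    have hwi : 0 ≤ w i := by simp [hw]; omega
    have hnorm : 16 * q - 1 ≤ Site.supNorm w := by
      rw [hw, Site.supNorm_update_neg]
      have h1 := Site.supNorm_le_supNorm_sub_add z (z + Pi.single i 1)
      have h2 : Site.supNorm (z - (z + Pi.single i 1)) ≤ 1 := by
        rw [sub_add_cancel_left, Site.supNorm_neg]
        exact Site.supNorm_single_one_le i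
      omega
    have h := step_bound_of_nonneg hβ hm0 hq hnorm hwi
    have heq : w + Pi.single i 1 = Function.update z i (-z i) := by
      funext j
      simp only [hw, Pi.add_apply, Site.update_neg_apply]
      by_cases hj : j = i
      · subst hj; simp
      · simp [hj]
    rw [heq, twoPointFree_reflection hβ, hw, twoPointFree_reflection hβ, abs_sub_comm] at h
    exact h

/-- **P2 at a growth scale** (`m = 64q`, `q ≥ 1`, `d = 4`, `m*(β) = 0`): for all `x, y ∈ Ann(m/2, 4m)`,
`|S(x) - S(y)| ≤ 256 (64r)⁴ (‖x-y‖_∞/‖x‖_∞) S(x)` — nearby points by the path lemma and the single-step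
bound, far points (`‖x-y‖_∞ ≥ m/8`) by P1. [cite: AizenmanDuminilCopinAnnals2021, arXiv:1912.07973 proof of Theorem 5.12 (P2, p. 20)] -/
theorem p2_of_growth (hβ : 0 ≤ β) (hm0 : spontaneousMagnetization 4 β = 0) {q r : ℕ} (hq : 1 ≤ q)
    (hr : 32 ≤ r)
    (hG : boxSusceptibility (twoPointFree 4 β) ((32 * (64 * q) : ℕ) : ℝ) +
        boxSusceptibility (twoPointFree 4 β) ((64 * q : ℕ) : ℝ) ≤
      boxSusceptibility (twoPointFree 4 β) ((r * (64 * q) : ℕ) : ℝ)) :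
    ∀ x ∈ ann 4 (64 * q / 2) (4 * (64 * q)), ∀ y ∈ ann 4 (64 * q / 2) (4 * (64 * q)),
      |twoPointFree 4 β x - twoPointFree 4 β y| ≤
        256 * (64 * (r : ℝ)) ^ 4 * ((Site.supNorm (x - y) : ℝ) / Site.supNorm x) * twoPointFree 4 β x := by
  intro x hx y hy
  set S := twoPointFree 4 β with hS
  set Θ : ℝ := (64 * (r : ℝ)) ^ 4 with hΘ
  set Up : ℝ := boxSusceptibility S ((64 * q : ℕ) : ℝ) / (2 * (q : ℝ) + 1) ^ 4 with hUp
  rw [mem_ann] at hx hy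
  have hq' : (1 : ℝ) ≤ q := by exact_mod_cast hq
  have hΘ1 : 1 ≤ Θ := by
    rw [hΘ]
    have : (32 : ℝ) ≤ r := by exact_mod_cast hr
    exact one_le_pow₀ (by linarith)
  have hSx : 0 ≤ S x := twoPointFree_nonneg_of_nonneg hβ x
  have hSy : 0 ≤ S y := twoPointFree_nonneg_of_nonneg hβ y
  have hxpos : (0 : ℝ) < Site.supNorm x := by
    have : (32 : ℝ) * q ≤ Site.supNorm x := by exact_mod_cast (show 32 * q ≤ Site.supNorm x by omega)
    linarith
  have hUpx : Up ≤ Θ * S x := upper_ref_le_mul_of_growth hβ hq hr hG (by omega)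
  have hyx : S y ≤ Θ * S x := twoPointFree_le_mul_of_growth hβ hq hr hG (by omega) (by omega)
  have hΘ0 : 0 ≤ Θ := zero_le_one.trans hΘ1
  have hxx : S x ≤ Θ * S x := le_mul_of_one_le_left hSx hΘ1
  -- the ratio `‖x - y‖ / ‖x‖`
  set ρ : ℝ := (Site.supNorm (x - y) : ℝ) / Site.supNorm x with hρ
  have hρ0 : 0 ≤ ρ := by positivity
  by_cases hfar : 8 * q ≤ Site.supNorm (x - y)
  · -- far points: `|S x - S y| ≤ Θ S(x)` and `1 ≤ 32 ρ`
    have h1 : |S x - S y| ≤ Θ * S x := by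
      rw [abs_le]; constructor <;> linarith
    have h2 : (1 : ℝ) ≤ 32 * ρ := by
      rw [hρ, mul_div_assoc', le_div_iff₀ hxpos]
      have h256 : (Site.supNorm x : ℝ) ≤ 256 * q := by exact_mod_cast (show Site.supNorm x ≤ 256 * q by omega)
      have h8 : (8 : ℝ) * q ≤ Site.supNorm (x - y) := by exact_mod_cast hfar
      linarith
    calc |S x - S y| ≤ Θ * S x := h1
      _ ≤ Θ * S x * (32 * ρ) := le_mul_of_one_le_right (mul_nonneg hΘ0 hSx) h2
      _ = 32 * (Θ * ρ * S x) := by ring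
      _ ≤ 256 * (Θ * ρ * S x) :=
          mul_le_mul_of_nonneg_right (by norm_num) (mul_nonneg (mul_nonneg hΘ0 hρ0) hSx)
      _ = 256 * Θ * ρ * S x := by ring
  · -- nearby points: path lemma with the single-step bound
    push Not at hfar
    have hstep : ∀ z ∈ {z : Site 4 | 16 * q ≤ Site.supNorm z}, ∀ i : Fin 4,
        |S (z + Pi.single i 1) - S z| ≤ Up / (4 * (q : ℝ) + 1) := fun z hz i =>
      step_bound hβ hm0 hq hz i
    have hhull : ∀ z, Site.InHull x y z → z ∈ {z : Site 4 | 16 * q ≤ Site.supNorm z} := by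
      intro z hz
      have h1 := Site.supNorm_sub_le_of_inHull hz
      have h2 := Site.supNorm_le_supNorm_sub_add x z
      rw [Site.supNorm_sub_comm x z] at h2
      show 16 * q ≤ Site.supNorm z
      omega
    have hpath := abs_sub_le_mul_l1Dist_of_steps hstep (Site.l1Dist x y) x y rfl hhull
    have hl1 : (Site.l1Dist x y : ℝ) ≤ 4 * Site.supNorm (x - y) := by
      exact_mod_cast Site.l1Dist_le_mul_supNorm x y
    have hκ0 : 0 ≤ Up / (4 * (q : ℝ) + 1) :=
      div_nonneg (div_nonneg (boxSusceptibility_nonneg (twoPointFree_nonneg_of_nonneg hβ) _)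
        (by positivity)) (by positivity)
    -- `1/(4q+1) ≤ 64/‖x‖`
    have hinv : (Site.supNorm (x - y) : ℝ) / (4 * (q : ℝ) + 1) ≤ 64 * ρ := by
      rw [hρ, mul_div_assoc', div_le_div_iff₀ (by positivity) hxpos]
      have h256 : (Site.supNorm x : ℝ) ≤ 256 * q := by exact_mod_cast (show Site.supNorm x ≤ 256 * q by omega)
      have h0 : (0 : ℝ) ≤ Site.supNorm (x - y) := Nat.cast_nonneg _
      nlinarith
    calc |S x - S y| ≤ Up / (4 * (q : ℝ) + 1) * Site.l1Dist x y := hpath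
      _ ≤ Up / (4 * (q : ℝ) + 1) * (4 * Site.supNorm (x - y)) := mul_le_mul_of_nonneg_left hl1 hκ0
      _ = 4 * Up * ((Site.supNorm (x - y) : ℝ) / (4 * (q : ℝ) + 1)) := by ring
      _ ≤ 4 * (Θ * S x) * (64 * ρ) := by
          refine mul_le_mul (mul_le_mul_of_nonneg_left hUpx (by norm_num)) hinv
            (div_nonneg (Nat.cast_nonneg _) (by positivity)) (mul_nonneg (by norm_num) (mul_nonneg hΘ0 hSx))
      _ = 256 * Θ * ρ * S x := by ring


/-- **A growth scale is regular** (the verification step of the proof of ADC Thm 5.12, `d = 4`): let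
`m = 64q` (`q ≥ 1`), `r ≥ 32`, `χ_{rm} ≥ χ_{32m} + χ_m` (growth), `χ_{Rm} ≤ K R² χ_m` for some `R ≥ 1`,
`K ≥ 0` with `8R² ≥ 81 K r⁴` (the sliding-scale infrared bound between `m` and `Rm`), and `m*(β) = 0`
(`0 ≤ β ≤ β_c`). Then `Ann(m/2, 4m)` is `(c, C)`-regular with `c = 1/(2r⁴)` and
`C = max(256 (64r)⁴, 4R)`. [cite: AizenmanDuminilCopinAnnals2021, arXiv:1912.07973 proof of Theorem 5.12 ("Let us verify that the different properties of regular scales are satisfied for such an m", p. 20)] -/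
theorem isRegularScale_of_growth (hβ : 0 ≤ β) (hm0 : spontaneousMagnetization 4 β = 0) {q r R : ℕ}
    (hq : 1 ≤ q) (hr : 32 ≤ r) (hR : 1 ≤ R)
    (hG : boxSusceptibility (twoPointFree 4 β) ((32 * (64 * q) : ℕ) : ℝ) +
        boxSusceptibility (twoPointFree 4 β) ((64 * q : ℕ) : ℝ) ≤
      boxSusceptibility (twoPointFree 4 β) ((r * (64 * q) : ℕ) : ℝ))
    {K : ℝ} (hK0 : 0 ≤ K)
    (hK : boxSusceptibility (twoPointFree 4 β) ((R * (64 * q) : ℕ) : ℝ) ≤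
      K * (R : ℝ) ^ 2 * boxSusceptibility (twoPointFree 4 β) ((64 * q : ℕ) : ℝ))
    (hRK : 81 * K * (r : ℝ) ^ 4 ≤ 8 * (R : ℝ) ^ 2) :
    IsRegularScale (twoPointFree 4 β) (1 / (2 * (r : ℝ) ^ 4)) (max (256 * (64 * (r : ℝ)) ^ 4) (4 * R)) (64 * q) := by
  set Θ : ℝ := (64 * (r : ℝ)) ^ 4 with hΘ
  have hΘ1 : 1 ≤ Θ := by
    have : (32 : ℝ) ≤ r := by exact_mod_cast hr
    exact one_le_pow₀ (by linarith)
  have hΘC : Θ ≤ max (256 * Θ) (4 * R) := le_trans (by linarith) (le_max_left _ _)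
  have hS0 : ∀ x, 0 ≤ twoPointFree 4 β x := twoPointFree_nonneg_of_nonneg hβ
  refine ⟨?_, ?_, ?_, ?_⟩
  · intro x hx y hy
    exact (p1_of_growth hβ hq hr hG x hx y hy).trans (mul_le_mul_of_nonneg_right hΘC (hS0 x))
  · intro x hx y hy
    refine (p2_of_growth hβ hm0 hq hr hG x hx y hy).trans ?_
    exact mul_le_mul_of_nonneg_right (mul_le_mul_of_nonneg_right (le_max_left _ _) (by positivity)) (hS0 x)
  · intro x hx y hy
    refine p3_of_growth hβ hq hr hR hG hK0 hK hRK x hx y ?_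
    refine lt_of_le_of_lt ?_ hy
    exact mul_le_mul_of_nonneg_right (le_max_right _ _) (Nat.cast_nonneg _)
  · exact p4_of_growth hβ hq hr hG

end Model

/-! ### Part G. Consequences of P2 for shifted arguments (ADC Remark 6.5) -/

section Shift

variable {S : Site d → ℝ} {c C : ℝ} {n : ℕ}

/-- A site of `Ann(n, 2n)` shifted by a vector of sup norm `≤ n/2` stays in the regular annulus
`Ann(n/2, 4n)`. [folklore] -/
theorem sub_mem_ann_of_mem_ann {y w : Site d} (hy : y ∈ ann d n (2 * n)) (hw : 2 * Site.supNorm w ≤ n) :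
    y - w ∈ ann d (n / 2) (4 * n) := by
  rw [mem_ann] at hy ⊢
  have h1 := Site.supNorm_le_supNorm_sub_add y w
  have h2 : Site.supNorm (y - w) ≤ Site.supNorm y + Site.supNorm w := by
    have := Site.supNorm_add_le y (-w)
    rwa [← sub_eq_add_neg, Site.supNorm_neg] at this
  constructor <;> omega

/-- **P2 for shifted arguments** (the mechanism of Aizenman–Duminil-Copin 2021, Remark 6.5: "When `y` is
in a regular scale, then `𝔸_y(m)` is equal to `Ann(m, 2m)` by Property P2 of regular scales", with
`𝔸_y(m) = {u ∈ Ann(m,2m) : ∀ x ∈ Λ_{m/d}, ⟨σ_xσ_y⟩ ≤ (1 + C|x-u|/|y|) ⟨σ_uσ_y⟩}` and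
`⟨σ_aσ_y⟩ = S(y - a)`): if `Ann(n/2, 4n)` is `(c, C)`-regular (`C ≥ 0`, `S ≥ 0`), `y ∈ Ann(n, 2n)` and
`‖w‖_∞, ‖w'‖_∞ ≤ n/2`, then `S(y - w) ≤ (1 + 4C ‖w - w'‖_∞/‖y‖_∞) S(y - w')`.
[cite: AizenmanDuminilCopinAnnals2021, arXiv:1912.07973 Remark 6.5 (p. 23) and Definition 5.11, P2 (p. 20)] -/
theorem IsRegularScale.shift_le (h : IsRegularScale S c C n) (hC : 0 ≤ C) (hS : ∀ x, 0 ≤ S x)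
    {y w w' : Site d} (hy : y ∈ ann d n (2 * n)) (hw : 2 * Site.supNorm w ≤ n)
    (hw' : 2 * Site.supNorm w' ≤ n) :
    S (y - w) ≤ (1 + 4 * C * ((Site.supNorm (w - w') : ℝ) / Site.supNorm y)) * S (y - w') := by
  have hyw := sub_mem_ann_of_mem_ann hy hw
  have hyw' := sub_mem_ann_of_mem_ann hy hw'
  have hp2 := h.p2 (y - w') hyw' (y - w) hyw
  have hdiff : y - w' - (y - w) = w - w' := by abel
  rw [hdiff] at hp2
  rw [mem_ann] at hy hyw'
  -- `‖y‖ ≤ ‖y - w'‖ + ‖w'‖ ≤ ‖y - w'‖ + ‖y‖/2`, so `‖y‖ ≤ 4 ‖y - w'‖`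
  have htri := Site.supNorm_le_supNorm_sub_add y w'
  have hn4 : Site.supNorm y ≤ 4 * Site.supNorm (y - w') := by omega
  rcases Nat.eq_zero_or_pos (Site.supNorm y) with hy0 | hypos
  · -- degenerate `y = 0` (then `n = 0`): everything is `S 0`-valued… just use P1 via P2 with zero ratio
    have hyw0 : Site.supNorm (y - w') = 0 := by omega
    have : |S (y - w') - S (y - w)| ≤ 0 := by
      refine hp2.trans ?_
      rw [hyw0, Nat.cast_zero, div_zero, mul_zero, zero_mul]
    have heq : S (y - w) = S (y - w') := by
      have := abs_nonpos_iff.1 this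
      linarith
    rw [heq, hy0, Nat.cast_zero, div_zero, mul_zero, add_zero, one_mul]
  have hypos' : (0 : ℝ) < Site.supNorm y := by exact_mod_cast hypos
  have hyw'pos : (0 : ℝ) < Site.supNorm (y - w') := by
    have : 0 < Site.supNorm (y - w') := by omega
    exact_mod_cast this
  have hratio : (Site.supNorm (w - w') : ℝ) / Site.supNorm (y - w') ≤
      4 * ((Site.supNorm (w - w') : ℝ) / Site.supNorm y) := by
    rw [mul_div_assoc', div_le_div_iff₀ hyw'pos hypos']
    have h4 : (Site.supNorm y : ℝ) ≤ 4 * Site.supNorm (y - w') := by exact_mod_cast hn4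
    have h0 : (0 : ℝ) ≤ Site.supNorm (w - w') := Nat.cast_nonneg _
    nlinarith
  have hSyw' := hS (y - w')
  have key : S (y - w) - S (y - w') ≤ C * ((Site.supNorm (w - w') : ℝ) / Site.supNorm (y - w')) * S (y - w') := by
    have := (abs_sub_comm (S (y - w')) (S (y - w))) ▸ hp2
    linarith [le_abs_self (S (y - w) - S (y - w')), this]
  calc S (y - w) ≤ S (y - w') + C * ((Site.supNorm (w - w') : ℝ) / Site.supNorm (y - w')) * S (y - w') := by
        linarith
    _ ≤ S (y - w') + C * (4 * ((Site.supNorm (w - w') : ℝ) / Site.supNorm y)) * S (y - w') := by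
        have := mul_le_mul_of_nonneg_left hratio hC
        nlinarith
    _ = (1 + 4 * C * ((Site.supNorm (w - w') : ℝ) / Site.supNorm y)) * S (y - w') := by ring

end Shift

end Literature.Probability.LatticeModels
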